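import Summits.Ventures.PercRepro.S1CoreCapSpecFourMain

/-!
# PercRepro — TOWARDS `Q*(5) = 11`: THE HEAVY-LINE AND TWO-LINE CASES (p1, gen 23)

The bookkeeping of `S1CoreCapSpecThree` / `S1CoreCapSpecFour` at nullity `5` (`S1CoreCapSpecFourMain` supplies
`exists_third` and `capPaper_three_le_two`). A line of weight `5` makes every other line a 3-point line with at
most one fat point (`shape_of_weight_five`), covered by it together with any two further lines
(`subset_of_weight_five`), hence the configuration has at most `4` lines (`card_le_four_of_weight_five`) and cap
sum `≤ 5 + 2 + 2 + 2 = 11` (`sum_cap_le_eleven_of_weight_five`). Two lines have caps summing to `≤ 10`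
(`cap_add_cap_le_ten`: two one-fat 4-point lines through their fat point). `sum_cap_le_eleven_unless` packages
both: what remains for `FourCapSpec capPaper 5 11` is the case of `≥ 3` lines all of weight `≤ 4`
(`proofs/P1-S4-CAPBRIDGE.md` §14). Axioms: standard.
-/

namespace PercRepro

namespace S1

namespace FourCap

variable {β : Type} [DecidableEq β]

section Five

variable {w : β → ℕ} {ls : Finset (Finset β)}
  (h1 : ∀ L ∈ ls, ∀ v ∈ L, w v = 1 ∨ w v = 2)
  (h2 : ∀ L ∈ ls, 3 ≤ L.card ∧ wsum w L ≤ 5)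
  (h3 : ∀ L ∈ ls, ∀ L' ∈ ls, L ≠ L' → (L ∩ L').card ≤ 1)
  (h4 : ∀ l : List (Finset β), l.Nodup → (∀ L ∈ l, L ∈ ls) → wsum w (unionL l) ≤ 5 + lineRank l)

include h1 h2 h3 h4

/-- **A line of weight `5` shapes the others** at nullity `5`: with a third line present, any other line has `3`
points and no fat point off the heavy line (the ordering heavy line first costs `3`, the other line
`|L₂| − 2 + fat (L₂ ∖ L₁)`, the third `≥ 1`). -/
theorem shape_of_weight_five {L₁ L₂ L₃ : Finset β} (hL₁ : L₁ ∈ ls) (hL₂ : L₂ ∈ ls) (hL₃ : L₃ ∈ ls)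
    (h21 : L₂ ≠ L₁) (h31 : L₃ ≠ L₁) (h32 : L₃ ≠ L₂) (hw5 : wsum w L₁ = 5) :
    L₂.card = 3 ∧ fat w (L₂ \ L₁) = 0 := by
  have hw : ∀ L ∈ ls, ∀ v ∈ L, 1 ≤ w v := fun L hL v hv => by rcases h1 L hL v hv with h | h <;> omega
  have hc := h4 [L₃, L₂, L₁] (by simp [h21, h31, h32]) (by simp [hL₁, hL₂, hL₃])
  obtain ⟨a1, b1, c1, d1⟩ := cost_step w L₁ [] (hw L₁ hL₁)
  obtain ⟨a2, b2, c2, d2⟩ := cost_step w L₂ [L₁] (hw L₂ hL₂)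
  obtain ⟨a3, b3, c3, d3⟩ := cost_step w L₃ [L₂, L₁] (hw L₃ hL₃)
  obtain ⟨e0, e1, e2, e3⟩ := cost_start w L₁
  have i2 : (L₂ ∩ unionL [L₁]).card ≤ 1 := by
    simp only [unionL, Finset.union_empty]
    exact h3 L₂ hL₂ L₁ hL₁ h21
  have i3 : (L₃ ∩ unionL [L₂, L₁]).card ≤ 2 := by
    simp only [unionL, Finset.union_empty]
    rw [Finset.inter_union_distrib_left]
    refine (Finset.card_union_le _ _).trans ?_
    have := h3 L₃ hL₃ L₂ hL₂ h32
    have := h3 L₃ hL₃ L₁ hL₁ h31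
    omega
  have f2 := wsum_sdiff_eq w L₂ (unionL [L₁]) (h1 L₂ hL₂)
  have hf : fat w (L₂ \ unionL [L₁]) = fat w (L₂ \ L₁) := by simp [unionL]
  have k1 := (h2 L₁ hL₁).1
  have k2 := (h2 L₂ hL₂).1
  have k3 := (h2 L₃ hL₃).1
  omega

/-- **A line of weight `5` covers with any two others**: a fourth line lies in the union of the heavy line and any
two further lines (`3 + 1 + 1` is already spent). -/
theorem subset_of_weight_five {L₁ A B C : Finset β} (hL₁ : L₁ ∈ ls) (hA : A ∈ ls) (hB : B ∈ ls) (hC : C ∈ ls)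
    (hA1 : A ≠ L₁) (hB1 : B ≠ L₁) (hBA : B ≠ A) (hC1 : C ≠ L₁) (hCA : C ≠ A) (hCB : C ≠ B)
    (hw5 : wsum w L₁ = 5) : ∀ v ∈ C, v ∈ B ∨ v ∈ A ∨ v ∈ L₁ := by
  have hw : ∀ L ∈ ls, ∀ v ∈ L, 1 ≤ w v := fun L hL v hv => by rcases h1 L hL v hv with h | h <;> omega
  have hc := h4 [C, B, A, L₁] (by simp [hA1, hB1, hBA, hC1, hCA, hCB]) (by simp [hL₁, hA, hB, hC])
  obtain ⟨a1, b1, c1, d1⟩ := cost_step w L₁ [] (hw L₁ hL₁)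
  obtain ⟨a2, b2, c2, d2⟩ := cost_step w A [L₁] (hw A hA)
  obtain ⟨a3, b3, c3, d3⟩ := cost_step w B [A, L₁] (hw B hB)
  obtain ⟨a4, b4, c4, d4⟩ := cost_step w C [B, A, L₁] (hw C hC)
  obtain ⟨e0, e1, e2, e3⟩ := cost_start w L₁
  have i2 : (A ∩ unionL [L₁]).card ≤ 1 := by
    simp only [unionL, Finset.union_empty]
    exact h3 A hA L₁ hL₁ hA1
  have i3 : (B ∩ unionL [A, L₁]).card ≤ 2 := by
    simp only [unionL, Finset.union_empty]
    rw [Finset.inter_union_distrib_left]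
    refine (Finset.card_union_le _ _).trans ?_
    have := h3 B hB A hA hBA
    have := h3 B hB L₁ hL₁ hB1
    omega
  have k1 := (h2 L₁ hL₁).1
  have kA := (h2 A hA).1
  have kB := (h2 B hB).1
  have kC := (h2 C hC).1
  have hzero : (C \ unionL [B, A, L₁]).card = 0 := by omega
  have hsub : C ⊆ unionL [B, A, L₁] := Finset.sdiff_eq_empty_iff_subset.1 (Finset.card_eq_zero.1 hzero)
  intro v hv
  have h := hsub hv
  rw [mem_unionL_iff] at h
  simpa using h

/-- **A line of weight `5` leaves room for at most three others** (the same incidence count as at nullity `4`). -/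
theorem card_le_four_of_weight_five {L₁ : Finset β} (hL₁ : L₁ ∈ ls) (hw5 : wsum w L₁ = 5) : ls.card ≤ 4 := by
  by_contra hlt
  push Not at hlt
  have hcard : 2 < (ls.erase L₁).card := by
    rw [Finset.card_erase_of_mem hL₁]; omega
  obtain ⟨a, b, c, ha, hb, hc, hab, hac, hbc⟩ := Finset.two_lt_card_iff.1 hcard
  have hb' : b ∈ (ls.erase L₁).erase a := Finset.mem_erase.2 ⟨hab.symm, hb⟩
  have hc' : c ∈ ((ls.erase L₁).erase a).erase b :=
    Finset.mem_erase.2 ⟨hbc.symm, Finset.mem_erase.2 ⟨hac.symm, hc⟩⟩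
  have hcard' : 0 < ((((ls.erase L₁).erase a).erase b).erase c).card := by
    rw [Finset.card_erase_of_mem hc', Finset.card_erase_of_mem hb', Finset.card_erase_of_mem ha,
      Finset.card_erase_of_mem hL₁]
    omega
  obtain ⟨d, hd⟩ := Finset.card_pos.1 hcard'
  simp only [Finset.mem_erase] at ha hb hc hd
  have ha3 : a.card = 3 := (shape_of_weight_five h1 h2 h3 h4 hL₁ ha.2 hb.2 ha.1 hb.1 hab.symm hw5).1
  obtain ⟨x, y, z, hxy, hxz, hyz, haeq⟩ := Finset.card_eq_three.1 ha3
  have hx : x ∈ a := by rw [haeq]; simp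
  have hy : y ∈ a := by rw [haeq]; simp
  have hz : z ∈ a := by rw [haeq]; simp
  have cbc := subset_of_weight_five h1 h2 h3 h4 hL₁ hb.2 hc.2 ha.2 hb.1 hc.1 hbc.symm ha.1 hab hac hw5
  have cbd := subset_of_weight_five h1 h2 h3 h4 hL₁ hb.2 hd.2.2.2.2 ha.2 hb.1 hd.2.2.2.1 hd.2.1 ha.1 hab
    (Ne.symm hd.2.2.1) hw5
  have ccd := subset_of_weight_five h1 h2 h3 h4 hL₁ hc.2 hd.2.2.2.2 ha.2 hc.1 hd.2.2.2.1 hd.1 ha.1 hac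
    (Ne.symm hd.2.2.1) hw5
  have col : ∀ L ∈ ls, L ≠ a → ∀ u ∈ a, ∀ u' ∈ a, u ≠ u' → u ∈ L → u' ∈ L → False := by
    intro L hL hne u hu u' hu' huu' huL hu'L
    exact huu' (Finset.card_le_one.1 (h3 L hL a ha.2 hne) u (Finset.mem_inter.2 ⟨huL, hu⟩) u'
      (Finset.mem_inter.2 ⟨hu'L, hu'⟩))
  have rx := ind_row_four (x ∈ L₁) (x ∈ b) (x ∈ c) (x ∈ d) (cbc x hx) (cbd x hx) (ccd x hx)
  have ry := ind_row_four (y ∈ L₁) (y ∈ b) (y ∈ c) (y ∈ d) (cbc y hy) (cbd y hy) (ccd y hy)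
  have rz := ind_row_four (z ∈ L₁) (z ∈ b) (z ∈ c) (z ∈ d) (cbc z hz) (cbd z hz) (ccd z hz)
  have k1 := ind_le_one (x ∈ L₁) (y ∈ L₁) (z ∈ L₁) (col L₁ hL₁ (Ne.symm ha.1) x hx y hy hxy)
    (col L₁ hL₁ (Ne.symm ha.1) x hx z hz hxz) (col L₁ hL₁ (Ne.symm ha.1) y hy z hz hyz)
  have kb := ind_le_one (x ∈ b) (y ∈ b) (z ∈ b) (col b hb.2 hab.symm x hx y hy hxy)
    (col b hb.2 hab.symm x hx z hz hxz) (col b hb.2 hab.symm y hy z hz hyz)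
  have kc := ind_le_one (x ∈ c) (y ∈ c) (z ∈ c) (col c hc.2 hac.symm x hx y hy hxy)
    (col c hc.2 hac.symm x hx z hz hxz) (col c hc.2 hac.symm y hy z hz hyz)
  have kd := ind_le_one (x ∈ d) (y ∈ d) (z ∈ d) (col d hd.2.2.2.2 hd.2.2.1 x hx y hy hxy)
    (col d hd.2.2.2.2 hd.2.2.1 x hx z hz hxz) (col d hd.2.2.2.2 hd.2.2.1 y hy z hz hyz)
  omega

/-- **With a line of weight `5` and at least three lines, the cap sum is `≤ 11`**: the heavy line has cap `≤ 5`,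
the at most three others are 3-point lines with at most one fat point each (cap `≤ 2`). -/
theorem sum_cap_le_eleven_of_weight_five (hbig : 2 < ls.card) {L₁ : Finset β} (hL₁ : L₁ ∈ ls)
    (hw5 : wsum w L₁ = 5) : ∑ L ∈ ls, capPaper L.card (fat w L) ≤ 11 := by
  have hm := card_le_four_of_weight_five h1 h2 h3 h4 hL₁ hw5
  have hothers : ∀ L ∈ ls.erase L₁, capPaper L.card (fat w L) ≤ 2 := by
    intro L hL
    rw [Finset.mem_erase] at hL
    obtain ⟨L₃, hL₃, h3L, h31⟩ := exists_third hbig hL.2 hL₁ hL.1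
    obtain ⟨hc, hf⟩ := shape_of_weight_five h1 h2 h3 h4 hL₁ hL.2 hL₃ hL.1 h31 h3L hw5
    have hsplit := fat_sdiff_add_fat_inter w L L₁
    have hmono : fat w (L ∩ L₁) ≤ (L ∩ L₁).card := Finset.card_le_card (Finset.filter_subset _ _)
    have hint := h3 L hL.2 L₁ hL₁ hL.1
    rw [hc]
    exact capPaper_three_le_two (by omega)
  have hcap₁ : capPaper L₁.card (fat w L₁) ≤ 5 := by
    have hk := (h2 L₁ hL₁).1
    have hcf := wsum_eq_card_add_fat w L₁ (h1 L₁ hL₁)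
    exact capPaper_le_five hk (by omega)
  rw [← Finset.add_sum_erase ls _ hL₁]
  have hsum : ∑ L ∈ ls.erase L₁, capPaper L.card (fat w L) ≤ ∑ L ∈ ls.erase L₁, 2 := Finset.sum_le_sum hothers
  rw [Finset.sum_const_nat (fun _ _ => rfl), Finset.card_erase_of_mem hL₁] at hsum
  omega

/-- **Two lines** at nullity `5` have caps summing to `≤ 10` (two one-fat 4-point lines through their fat point). -/
theorem cap_add_cap_le_ten {L L' : Finset β} (hL : L ∈ ls) (hL' : L' ∈ ls) (hne : L' ≠ L) :
    capPaper L.card (fat w L) + capPaper L'.card (fat w L') ≤ 10 := by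
  have hc := two_line_cost h4 hL hL' hne
  have hint : (L' ∩ L).card ≤ 1 := h3 L' hL' L hL hne
  have kL := h2 L hL
  have kL' := h2 L' hL'
  have wL := wsum_eq_card_add_fat w L (h1 L hL)
  have wL' := wsum_eq_card_add_fat w L' (h1 L' hL')
  have hsd : (L' \ L).card + (L' ∩ L).card = L'.card := by
    rw [Finset.card_sdiff, Finset.inter_comm]
    exact Nat.sub_add_cancel (Finset.card_le_card Finset.inter_subset_left)
  have hwu : wsum w (L' ∪ L) = wsum w L' + wsum w (L \ L') := (wsum_union_ge w L' L).symm
  have hsplit : wsum w (L \ L') + wsum w (L ∩ L') = wsum w L := by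
    rw [← wsum_union_of_disjoint w (Finset.disjoint_sdiff_inter L L'), Finset.sdiff_union_inter]
  have hcases : (L.card = 3 ∧ fat w L = 0) ∨ (L.card = 4 ∧ fat w L = 0) ∨ (L.card = 5 ∧ fat w L = 0) ∨
      (L.card = 3 ∧ fat w L = 1) ∨ (L.card = 4 ∧ fat w L = 1) ∨ (L.card = 3 ∧ fat w L = 2) := by omega
  have hcases' : (L'.card = 3 ∧ fat w L' = 0) ∨ (L'.card = 4 ∧ fat w L' = 0) ∨ (L'.card = 5 ∧ fat w L' = 0) ∨
      (L'.card = 3 ∧ fat w L' = 1) ∨ (L'.card = 4 ∧ fat w L' = 1) ∨ (L'.card = 3 ∧ fat w L' = 2) := by omega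
  have hcomm : (L ∩ L').card = (L' ∩ L).card := by rw [Finset.inter_comm]
  rcases (by omega : (L ∩ L').card = 0 ∨ (L ∩ L').card = 1) with h0 | hone
  · have hempty : wsum w (L ∩ L') = 0 := by
      rw [Finset.card_eq_zero.1 h0]; simp [wsum]
    rcases hcases with ⟨hk, hf⟩ | ⟨hk, hf⟩ | ⟨hk, hf⟩ | ⟨hk, hf⟩ | ⟨hk, hf⟩ | ⟨hk, hf⟩ <;>
      rcases hcases' with ⟨hk', hf'⟩ | ⟨hk', hf'⟩ | ⟨hk', hf'⟩ | ⟨hk', hf'⟩ | ⟨hk', hf'⟩ | ⟨hk', hf'⟩ <;>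
      first | omega | (rw [hk, hf, hk', hf']; decide)
  · obtain ⟨p, hp⟩ := Finset.card_eq_one.1 hone
    have hpL : p ∈ L := (Finset.mem_inter.1 (hp ▸ Finset.mem_singleton_self p)).1
    have hpL' : p ∈ L' := (Finset.mem_inter.1 (hp ▸ Finset.mem_singleton_self p)).2
    have hwp : wsum w (L ∩ L') = w p := by rw [hp]; simp [wsum]
    rcases h1 L hL p hpL with hp1 | hp2
    · rcases hcases with ⟨hk, hf⟩ | ⟨hk, hf⟩ | ⟨hk, hf⟩ | ⟨hk, hf⟩ | ⟨hk, hf⟩ | ⟨hk, hf⟩ <;>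
        rcases hcases' with ⟨hk', hf'⟩ | ⟨hk', hf'⟩ | ⟨hk', hf'⟩ | ⟨hk', hf'⟩ | ⟨hk', hf'⟩ | ⟨hk', hf'⟩ <;>
        first | omega | (rw [hk, hf, hk', hf']; decide)
    · have hfL : 1 ≤ fat w L := by
        unfold fat
        exact Finset.card_pos.2 ⟨p, Finset.mem_filter.2 ⟨hpL, hp2⟩⟩
      have hfL' : 1 ≤ fat w L' := by
        unfold fat
        exact Finset.card_pos.2 ⟨p, Finset.mem_filter.2 ⟨hpL', hp2⟩⟩
      rcases hcases with ⟨hk, hf⟩ | ⟨hk, hf⟩ | ⟨hk, hf⟩ | ⟨hk, hf⟩ | ⟨hk, hf⟩ | ⟨hk, hf⟩ <;>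
        rcases hcases' with ⟨hk', hf'⟩ | ⟨hk', hf'⟩ | ⟨hk', hf'⟩ | ⟨hk', hf'⟩ | ⟨hk', hf'⟩ | ⟨hk', hf'⟩ <;>
        first | omega | (rw [hk, hf, hk', hf']; decide)

/-- **The instance `ν = 5` modulo the one remaining case**: `Σ cap ≤ 11` for every configuration with at most
two lines or with a line of weight `5`; what is left for `Q*(5) = 11` is `≥ 3` lines all of weight `≤ 4`. -/
theorem sum_cap_le_eleven_unless (hrest : 2 < ls.card → (∀ L ∈ ls, wsum w L ≤ 4) →
    ∑ L ∈ ls, capPaper L.card (fat w L) ≤ 11) : ∑ L ∈ ls, capPaper L.card (fat w L) ≤ 11 := by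
  by_cases hbig : 2 < ls.card
  · by_cases hex : ∃ L ∈ ls, wsum w L = 5
    · obtain ⟨L₁, hL₁, hw5⟩ := hex
      exact sum_cap_le_eleven_of_weight_five h1 h2 h3 h4 hbig hL₁ hw5
    · push Not at hex
      exact hrest hbig (fun L hL => by have := (h2 L hL).2; have := hex L hL; omega)
  · push Not at hbig
    rcases (by omega : ls.card = 0 ∨ ls.card = 1 ∨ ls.card = 2) with h0 | hone | htwo
    · rw [Finset.card_eq_zero.1 h0]
      simp
    · obtain ⟨L, rfl⟩ := Finset.card_eq_one.1 hone
      rw [Finset.sum_singleton]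
      have hk := h2 L (Finset.mem_singleton_self L)
      have hcf := wsum_eq_card_add_fat w L (h1 L (Finset.mem_singleton_self L))
      exact (capPaper_le_five hk.1 (by omega)).trans (by omega)
    · obtain ⟨L, L', hne, rfl⟩ := Finset.card_eq_two.1 htwo
      rw [Finset.sum_pair hne]
      exact (cap_add_cap_le_ten h1 h2 h3 h4 (by simp) (by simp) hne.symm).trans (by omega)

end Five

end FourCap

end S1

end PercRepro
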